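import Literature.NumberTheory.LFunctions.FordLargeLambda
import Literature.NumberTheory.LFunctions.FordLargeLambdaCheck2
import HarnessLib

/-!
# Ford's Theorem 2 for `87 ≤ λ ≤ 2025` from the `θ'`-rows of (1.7) and Theorem 4'

Topic `Literature/NumberTheory/LFunctions`. Pure proof file (no `def`): the assembly
`FordVK.expSum_bound_lambda_87_2025` (`FordLargeLambda.lean`) re-run through
`FordVK.Sec5Row.sound2` (`FordLargeLambdaCheck2.lean`), i.e. through `FordVK.sec5_interval2`:
the SAME certified rows (`FordVK.rowsAll`, `FordVK.rowsAll_check`, `FordVK.rowsAll_chain`), one more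
cheap kernel check (`FordVK.rowsAll_ks`: `k² ≤ 120 s` for every row), and the inputs the tree
actually proves — the rows of (1.7) at `θ' = 2.3296 / 2.3856 / 2.4191` (hypotheses `hT3a–c`, the
shapes of `FordTheorem3Rows.lean`) and Theorem 4' (hypothesis `hT4'`, the shape of
`FordVK.ford_theorem4_lib`).  The price is the constant: `10.031` for `9.463`.

* `FordVK.expSum_bound_lambda_87_2025'` — **Theorem 2 of [Ford2002] for `N^{87} ≤ t ≤ N^{2025}`
  with constant `10.031`**, from `hT3a–c` (at `θ'`) and `hT4'`.

## References
* K. Ford, Proc. London Math. Soc. (3) 85 (2002), 565–633; arXiv:1910.08209: Theorem 2, §5,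
  Lemmas 5.2–5.3. [Ford2002]
-/

open Finset Real

namespace Literature.NumberTheory.LFunctions
namespace FordVK

set_option maxHeartbeats 0 in
/-- Every certified row has `k² ≤ 120 s` (kernel computation). [cite: Ford2002, proof of Lemma 5.3 (Program 2)] -/
theorem rowsAll_ks : rowsAll.all (fun R => decide (R.k ^ 2 ≤ 120 * R.s)) = true := by
  decide +kernel

/-- **Ford's Theorem 2 for `N^{87} ≤ t ≤ N^{2025}` with constant `10.031`, from the `θ'`-rows of
(1.7) and Theorem 4'**: `‖∑_{N<n≤R} (n+u)^{-it}‖ ≤ 10.031 N^{1 − (log N)²/(133.66 (log t)²)}` for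
`1 ≤ N < R ≤ 2N`, `0 < u ≤ 1`. [cite: Ford2002, Theorem 2 (proof, §5, Lemmas 5.2–5.3)] -/
theorem expSum_bound_lambda_87_2025'
    (hT3a : ∀ k : ℕ, 200 ≤ k → ∃ s₃ : ℕ, 1 ≤ s₃ ∧ (s₃ : ℝ) ≤ 3.21432 * (k : ℝ) ^ 2 ∧ ∀ P : ℕ, 1 ≤ P →
      (VMV.J k s₃ (Finset.Icc (1 : ℤ) P) : ℝ) ≤ (k : ℝ) ^ (2.3296 * (k : ℝ) ^ 3)
        * (P : ℝ) ^ ((2 * s₃ : ℝ) - ((k * (k + 1) / 2 : ℕ) : ℝ) + 0.001 * (k : ℝ) ^ 2))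
    (hT3b : ∀ k : ℕ, 150 ≤ k → k ≤ 199 → ∃ s₃ : ℕ, 1 ≤ s₃ ∧ (s₃ : ℝ) ≤ 3.21734 * (k : ℝ) ^ 2 ∧ ∀ P : ℕ, 1 ≤ P →
      (VMV.J k s₃ (Finset.Icc (1 : ℤ) P) : ℝ) ≤ (k : ℝ) ^ (2.3856 * (k : ℝ) ^ 3)
        * (P : ℝ) ^ ((2 * s₃ : ℝ) - ((k * (k + 1) / 2 : ℕ) : ℝ) + 0.001 * (k : ℝ) ^ 2))
    (hT3c : ∀ k : ℕ, 129 ≤ k → k ≤ 149 → ∃ s₃ : ℕ, 1 ≤ s₃ ∧ (s₃ : ℝ) ≤ 3.22313 * (k : ℝ) ^ 2 ∧ ∀ P : ℕ, 1 ≤ P →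
      (VMV.J k s₃ (Finset.Icc (1 : ℤ) P) : ℝ) ≤ (k : ℝ) ^ (2.4191 * (k : ℝ) ^ 3)
        * (P : ℝ) ^ ((2 * s₃ : ℝ) - ((k * (k + 1) / 2 : ℕ) : ℝ) + 0.001 * (k : ℝ) ^ 2))
    (hT4' : ∀ (k h s : ℕ) (P η D : ℝ), 60 ≤ k → (0.9 : ℝ) * k ≤ h → h + 2 ≤ k →
      2 * (k - h + 1) ≤ s → s ≤ (h / 2) * (k - h + 1) → 10 ≤ D → Real.exp (D * (k : ℝ) ^ 2) ≤ P →
      2 / (k : ℝ) ^ 3 < η → η ≤ 1 / (2 * (k : ℝ)) →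
      18 / (k : ℝ) ≤ 4 * Real.log k / (D * (k : ℝ) ^ 2 * η) →
      4 * Real.log k / (D * (k : ℝ) ^ 2 * η) ≤ 0.4 → 80 ≤ η * Real.log P →
      (Jinc k s ((calC P (P ^ η)).map Nat.castEmbedding) h k : ℝ)
        ≤ Real.exp ((s : ℝ) ^ 2 / ((k : ℝ) - h + 1)
            + 10.5 * ((k : ℝ) - h + 1) * Real.log k ^ 2 / (D * k * η ^ 2)
            - s * ((1 / η + h) * (1 - 1 / (h : ℝ)) ^ ((s : ℝ) / ((k : ℝ) - h + 1)) - h)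
              * Real.log (1 / (12 * η)))
          * P ^ ((2 * s : ℝ) - ((k : ℝ) - h + 1) / 2 * (h + k) + ((k : ℝ) - h + 1) * ((k : ℝ) - h) / 2
            + η * (s : ℝ) ^ 2 / (2 * ((k : ℝ) - h + 1))
            + h * ((k : ℝ) - h + 1) * Real.exp (-(s : ℝ) / (h * ((k : ℝ) - h + 1)))))
    {N R₀ : ℕ} {t u : ℝ} (hN : 1 ≤ N) (hNR : N < R₀) (hR : R₀ ≤ 2 * N) (hu0 : 0 < u) (hu1 : u ≤ 1)
    (ht1 : (N : ℝ) ^ (87 : ℕ) ≤ t) (ht2 : t ≤ (N : ℝ) ^ (2025 : ℕ)) :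
    ‖∑ n ∈ Ioc N R₀, ((n : ℂ) + u) ^ (-(t * Complex.I))‖
      ≤ 10.031 * (N : ℝ) ^ (1 - Real.log N ^ 2 / (133.66 * Real.log t ^ 2)) := by
  have hS := norm_shifted_sum_le_trivial hR hu0 (t := t)
  rcases eq_or_lt_of_le hN with hN1 | hN2
  · -- `N = 1`
    subst hN1
    simp only [Nat.cast_one, Real.one_rpow, mul_one] at hS ⊢
    linarith
  -- `N ≥ 2`
  have hN0 : (0 : ℝ) < N := by positivity
  have hN1' : (1 : ℝ) < N := by exact_mod_cast hN2
  have hL : 0 < Real.log N := Real.log_pos hN1'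
  have hNpow : (1 : ℝ) < (N : ℝ) ^ (87 : ℕ) := one_lt_pow₀ hN1' (by norm_num)
  have ht1' : 1 < t := lt_of_lt_of_le hNpow ht1
  have ht0 : 0 < t := by linarith
  have hlog1 : (87 : ℝ) * Real.log N ≤ Real.log t := by
    have := Real.log_le_log (by positivity) ht1
    rwa [Real.log_pow, Nat.cast_ofNat] at this
  have hlog2 : Real.log t ≤ 2025 * Real.log N := by
    have := Real.log_le_log ht0 ht2
    rwa [Real.log_pow, Nat.cast_ofNat] at this
  by_cases hsmall : Real.log N ^ 3 ≤ 300 * Real.log t ^ 2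
  · have h := expSum_bound_trivial_range hN hR hu0 ht1' hsmall (R₀ := R₀)
    refine (h.trans ?_)
    exact mul_le_mul_of_nonneg_right (by norm_num) (by positivity)
  · push Not at hsmall
    have hbig : 300 * (Real.log t / Real.log N) ^ 2 ≤ Real.log N := by
      rw [div_pow, ← mul_div_assoc, div_le_iff₀ (by positivity)]
      nlinarith [hsmall]
    set lam := Real.log t / Real.log N with hlam
    have hlam1 : ((87 * 10 ^ 10 : ℕ) : ℝ) / 10 ^ 10 ≤ lam := by
      rw [hlam, le_div_iff₀ hL]; push_cast; linarith
    have hlam2 : lam ≤ ((2025 * 10 ^ 10 : ℕ) : ℝ) / 10 ^ 10 := by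
      rw [hlam, div_le_iff₀ hL]; push_cast; linarith
    obtain ⟨R, hRmem, h1, h2⟩ := Sec5Row.exists_mem_of_chainOK' rowsAll_chain rowsAll_ne_nil hlam1 hlam2
    have hcheck : R.check = true := List.all_eq_true.1 rowsAll_check R hRmem
    have hks : R.k ^ 2 ≤ 120 * R.s := of_decide_eq_true (List.all_eq_true.1 rowsAll_ks R hRmem)
    have hlo : (R.lamloN : ℝ) / R.lamD * Real.log N ≤ Real.log t := by
      rw [hlam, le_div_iff₀ hL] at h1; exact h1
    have hhi : Real.log t ≤ (R.lamhiN : ℝ) / R.lamD * Real.log N := by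
      rw [hlam, div_le_iff₀ hL] at h2; exact h2
    exact R.sound2 hcheck hks hT3a hT3b hT3c hT4' (by omega) hNR hR hu0 hu1 ht0 hlo hhi hbig

end FordVK
end Literature.NumberTheory.LFunctions
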